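import Mathlib

/-!
# Tier4/Line1/AddFundamentalDomainOfCompact — the additive twin of `FundamentalDomainOfCompact` (rung C4 support)

Blind re-derivation cell `pub-hodge-repro`, Tier 4 (README §9–§10), seat t4-L1-p5 (prover, LINE L1, gen 0).
Mathlib only.  The generic construction of `Tier4/Line1/FundamentalDomainOfCompact.lean` (p662894) — a discrete countable
subgroup `Γ` with a compact `C`, `Γ · C = G`, has a measurable exact transversal inside `C` — for ADDITIVE groups, as the
adelic Minkowski step (C4) of the R-c cut needs it for `k⁴ ⊆ 𝔸_k⁴` under translation.  Same proof, additively.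

Nothing here says anything about the status of the Hodge conjecture for CM abelian varieties, which is NOT proved
(HC_CM is NOT proved by anyone in this repository).
-/

set_option autoImplicit false

noncomputable section

namespace Summit.Ventures.HodgeRepro.Tier4.Line1

open MeasureTheory Topology Set
open scoped Pointwise

section GenericAdd

variable {G : Type*} [AddCommGroup G] [TopologicalSpace G] [IsTopologicalAddGroup G]

/-- A discrete subgroup `Γ` of a topological group admits an open neighbourhood `V` of `1` with
`V V⁻¹ ∩ Γ = {1}`: if `a, b ∈ V` and `a b⁻¹ ∈ Γ` then `a = b`. -/
theorem exists_open_nhds_zero_of_discrete' (Γ : AddSubgroup G) [DiscreteTopology Γ] :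
    ∃ V : Set G, IsOpen V ∧ (0 : G) ∈ V ∧ ∀ a ∈ V, ∀ b ∈ V, a - b ∈ Γ → a = b := by
  have h1 : IsOpen ({0} : Set Γ) := isOpen_discrete _
  obtain ⟨U, hU, hU1⟩ := isOpen_induced_iff.1 h1
  have hU1' : (0 : G) ∈ U := by
    have : (0 : Γ) ∈ Subtype.val ⁻¹' U := by
      rw [hU1]
      exact Set.mem_singleton _
    exact this
  obtain ⟨V₀, hV₀, h1V₀, hV₀U⟩ := exists_open_nhds_zero_half (hU.mem_nhds hU1')
  refine ⟨V₀ ∩ -V₀, hV₀.inter hV₀.neg, ⟨h1V₀, by simpa using h1V₀⟩, ?_⟩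
  rintro a ⟨ha, -⟩ b ⟨-, hb⟩ hab
  have hmem : a - b ∈ U := by
    rw [sub_eq_add_neg]
    exact hV₀U a ha (-b) (Set.mem_neg.1 hb)
  have hmem' : (⟨a - b, hab⟩ : Γ) ∈ Subtype.val ⁻¹' U := hmem
  rw [hU1] at hmem'
  have h : a - b = 0 := congrArg Subtype.val (Set.mem_singleton_iff.1 hmem')
  exact sub_eq_zero.1 h

variable [T2Space G] [MeasurableSpace G] [BorelSpace G]

/-- **The generic reduction.**  `Γ` a discrete countable subgroup of the Hausdorff topological group `G`, `C ⊆ G`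
compact with `Γ · C = G`: for every measure `μ` on `G` there is a measurable `D ⊆ C` which is a fundamental domain
for the left action of `Γ` (every orbit meets `D` exactly once). -/
theorem exists_isAddFundamentalDomain_subset_of_isCompact (Γ : AddSubgroup G) [DiscreteTopology Γ]
    [Countable Γ] (μ : Measure G) {C : Set G} (hC : IsCompact C)
    (hcov : ∀ x : G, ∃ γ : Γ, ∃ c ∈ C, x = (γ : G) + c) :
    ∃ D : Set G, D ⊆ C ∧ MeasurableSet D ∧ IsAddFundamentalDomain Γ D μ := by
  classical
  obtain ⟨V, hV, h1V, hVΓ⟩ := exists_open_nhds_zero_of_discrete' Γ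
  -- the open cover of `C` by the right translates `V x`, `x ∈ C`, and a finite subcover
  have hcover : C ⊆ ⋃ x : C, (fun v => v + (x : G)) '' V := fun c hc =>
    Set.mem_iUnion.2 ⟨⟨c, hc⟩, ⟨0, h1V, zero_add c⟩⟩
  obtain ⟨t, ht⟩ := hC.elim_finite_subcover (fun x : C => (fun v => v + (x : G)) '' V)
    (fun x => (Homeomorph.addRight (x : G)).isOpenMap V hV) hcover
  -- enumerate the finite subcover by `Fin n`
  let n := t.card
  let x : Fin n → G := fun i => ((t.equivFin.symm i).1 : C)
  have hx : ∀ c ∈ C, ∃ i : Fin n, c ∈ (fun v => v + x i) '' V := by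
    intro c hc
    obtain ⟨i, hi, hci⟩ := Set.mem_iUnion₂.1 (ht hc)
    refine ⟨t.equivFin ⟨i, hi⟩, ?_⟩
    have hxi : x (t.equivFin ⟨i, hi⟩) = (i : G) := by
      simp only [x, Equiv.symm_apply_apply]
    rw [hxi]
    exact hci
  -- the pieces
  let A : Fin n → Set G := fun i => ((fun v => v + x i) '' V) ∩ C
  have hAmeas : ∀ i, MeasurableSet (A i) := fun i =>
    ((Homeomorph.addRight (x i)).isOpenMap V hV).measurableSet.inter hC.isClosed.measurableSet
  have hAC : ∀ i, A i ⊆ C := fun i => Set.inter_subset_right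
  let B : Fin n → Set G := fun i => ⋃ (j : Fin n) (_ : j < i), ⋃ γ : Γ, (γ : G) +ᵥ A j
  have hBmeas : ∀ i, MeasurableSet (B i) := fun i =>
    MeasurableSet.iUnion fun j => MeasurableSet.iUnion fun _ => MeasurableSet.iUnion fun γ =>
      (hAmeas j).const_vadd (γ : G)
  have hmemB : ∀ i (z : G), z ∈ B i ↔ ∃ j : Fin n, j < i ∧ ∃ γ : Γ, -(γ : G) + z ∈ A j := by
    intro i z
    simp only [B, Set.mem_iUnion, Set.mem_vadd_set_iff_neg_vadd_mem, vadd_eq_add]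
    exact ⟨fun ⟨j, hj, γ, h⟩ => ⟨j, hj, γ, h⟩, fun ⟨j, hj, γ, h⟩ => ⟨j, hj, γ, h⟩⟩
  let D : Set G := ⋃ i, A i \ B i
  have hDmeas : MeasurableSet D := MeasurableSet.iUnion fun i => (hAmeas i).diff (hBmeas i)
  refine ⟨D, Set.iUnion_subset fun i => Set.sdiff_subset.trans (hAC i), hDmeas, ?_⟩
  refine IsAddFundamentalDomain.mk' hDmeas.nullMeasurableSet ?_
  intro y
  -- the orbit of `y` meets some piece: pick the least index
  have hP : ∃ m : ℕ, ∃ hm : m < n, ∃ γ : Γ, (γ : G) + y ∈ A ⟨m, hm⟩ := by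
    obtain ⟨γ₀, c, hc, rfl⟩ := hcov y
    obtain ⟨i, hi⟩ := hx c hc
    refine ⟨i.1, i.2, -γ₀, ?_⟩
    have : ((-γ₀ : Γ) : G) + ((γ₀ : G) + c) = c := by
      rw [AddSubgroup.coe_neg, neg_add_cancel_left]
    rw [this]
    exact ⟨hi, hc⟩
  let i₀ : Fin n := ⟨Nat.find hP, (Nat.find_spec hP).1⟩
  obtain ⟨γ₁, hγ₁⟩ := (Nat.find_spec hP).2
  have hγ₁A : (γ₁ : G) + y ∈ A i₀ := hγ₁
  have hγ₁B : (γ₁ : G) + y ∉ B i₀ := by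
    intro hB
    obtain ⟨j, hj, γ', hmem⟩ := (hmemB i₀ _).1 hB
    have hjlt : j.1 < Nat.find hP := hj
    refine Nat.find_min hP hjlt ⟨j.2, -γ' + γ₁, ?_⟩
    have : ((-γ' + γ₁ : Γ) : G) + y = -(γ' : G) + ((γ₁ : G) + y) := by
      rw [AddSubgroup.coe_add, AddSubgroup.coe_neg, add_assoc]
    rw [this]
    exact hmem
  have hD : ∀ γ : Γ, γ +ᵥ y ∈ D ↔ ∃ i : Fin n, (γ : G) + y ∈ A i ∧ (γ : G) + y ∉ B i := by
    intro γ
    simp only [D, Set.mem_iUnion, Set.mem_sdiff]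
    rfl
  refine ⟨γ₁, (hD γ₁).2 ⟨i₀, hγ₁A, hγ₁B⟩, ?_⟩
  -- uniqueness
  intro γ₂ hγ₂
  obtain ⟨i₂, hA₂, hB₂⟩ := (hD γ₂).1 hγ₂
  -- the two indices agree
  have hi : i₂ = i₀ := by
    rcases lt_trichotomy i₂ i₀ with hlt | heq | hgt
    · exact absurd ((hmemB i₀ _).2 ⟨i₂, hlt, γ₁ - γ₂, by
        have : -((γ₁ - γ₂ : Γ) : G) + ((γ₁ : G) + y) = (γ₂ : G) + y := by
          rw [AddSubgroup.coe_sub]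
          abel
        rw [this]
        exact hA₂⟩) hγ₁B
    · exact heq
    · exact absurd ((hmemB i₂ _).2 ⟨i₀, hgt, γ₂ - γ₁, by
        have : -((γ₂ - γ₁ : Γ) : G) + ((γ₂ : G) + y) = (γ₁ : G) + y := by
          rw [AddSubgroup.coe_sub]
          abel
        rw [this]
        exact hγ₁A⟩) hB₂
  rw [hi] at hA₂ hB₂
  -- both lie in the same translate `V x`, so they differ by an element of `V V⁻¹ ∩ Γ = {1}`
  obtain ⟨v₁, hv₁, hv₁y⟩ := hγ₁A.1
  obtain ⟨v₂, hv₂, hv₂y⟩ := hA₂.1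
  have hvv : v₁ - v₂ ∈ Γ := by
    have e : v₁ - v₂ = ((γ₁ - γ₂ : Γ) : G) := by
      rw [AddSubgroup.coe_sub]
      have h1 : v₁ = (γ₁ : G) + y - x i₀ := by
        rw [← hv₁y]
        simp only [add_sub_cancel_right]
      have h2 : v₂ = (γ₂ : G) + y - x i₀ := by
        rw [← hv₂y]
        simp only [add_sub_cancel_right]
      rw [h1, h2]
      abel
    rw [e]
    exact Subtype.mem _
  have hv : v₁ = v₂ := hVΓ v₁ hv₁ v₂ hv₂ hvv
  have hy : (γ₂ : G) + y = (γ₁ : G) + y := by rw [← hv₁y, ← hv₂y, hv]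
  exact Subtype.ext (add_right_cancel hy)

/-- The same, packaged as in (I1-c): a fundamental domain with compact closure. -/
theorem exists_isAddFundamentalDomain_isCompact_closure_of_isCompact (Γ : AddSubgroup G)
    [DiscreteTopology Γ] [Countable Γ] (μ : Measure G) {C : Set G} (hC : IsCompact C)
    (hcov : ∀ x : G, ∃ γ : Γ, ∃ c ∈ C, x = (γ : G) + c) :
    ∃ D : Set G, IsAddFundamentalDomain Γ D μ ∧ IsCompact (closure D) := by
  obtain ⟨D, hDC, -, hD⟩ := exists_isAddFundamentalDomain_subset_of_isCompact Γ μ hC hcov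
  exact ⟨D, hD, hC.closure_of_subset hDC⟩

end GenericAdd

end Summit.Ventures.HodgeRepro.Tier4.Line1

end
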